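import Mathlib.MeasureTheory.Group.FundamentalDomain
import Literature.Probability.RandomPlanarGeometry.HaarSL2R
import Literature.Probability.RandomPlanarGeometry.ModularLoopEnsemble
import Literature.NumberTheory.Automorphic.HyperbolicLaplaceSpectrum
import HarnessLib

/-!
# The law of the modular loop ensemble and its Möbius invariance

Support file for the discharge of the named fact
`Literature.Probability.RandomPlanarGeometry.exists_isCLEFamily` (`CLE.lean`). The random element driving
the ensemble `modularLoops g` (`ModularLoopEnsemble.lean`) is `g ∈ SL(2, ℝ)` sampled from the normalised
restriction of the bi-invariant Haar measure `SL2R.haar` (`HaarSL2R.lean`) to a fundamental domain of the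
left action of `SL(2, ℤ)`; since `modularLoops (γ g) = modularLoops g`, the law `modularLaw` of the
ensemble is that of a uniform point of `SL(2, ℤ) \ SL(2, ℝ)` (finite volume: `vol 𝒟 = π / 3`,
`Literature.NumberTheory.Automorphic.volume_modular_fd`).

* `fdSL`: the fundamental domain `{g : g • i ∈ 𝒟, κ(g) ∈ K⁺}` in `SL(2, ℝ)` (`𝒟` the standard
  fundamental domain in `ℍ`, `K⁺` a half of the circle group `K = Stab(i)` taking care of `-1 ∈ SL(2, ℤ)`),
  `isFundamentalDomain_fdSL` (Mathlib `IsFundamentalDomain` for the left action of the image of `SL(2, ℤ)`).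
* `drivingLaw := (haar fdSL)⁻¹ • haar|fdSL`, a probability measure on `SL(2, ℝ)`; right translation
  invariance of the law of `SL(2, ℤ)`-invariant observables (`drivingLaw_preimage_mul_right`, unimodularity
  plus change of fundamental domain).
* `modularLaw := drivingLaw.map modularLoops` and its **Möbius invariance**
  (`map_modularLaw_eq`): pushing forward along any uniformly continuous map of `ℂ` that is a disc Möbius
  map on the open disc preserves `modularLaw`.
* Almost surely the moved point `g • z₀` lies in an `SL(2, ℤ)`-translate of the *open* fundamental
  domain (`ae_exists_smul_mem_fdo`).

## References

* S. Lang, *SL₂(ℝ)*, GTM 105 (1985), Ch. III §1 (Haar measure, unimodularity, `G/Γ`).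
* J.-P. Serre, *A Course in Arithmetic*, GTM 7 (1973), Ch. VII §1 (fundamental domain of `SL₂(ℤ)`).
-/

noncomputable section

open Set Filter Topology MeasureTheory UpperHalfPlane
open scoped MatrixGroups Modular ENNReal Pointwise

namespace Literature.Probability.RandomPlanarGeometry

namespace ModularEnsemble

open SL2R

/-! ### The image of `SL(2, ℤ)` acting on `SL(2, ℝ)` by left multiplication -/

/-- The image of `SL(2, ℤ)` in `SL(2, ℝ)` is countable. [folklore] -/
instance countable_modularRange : Countable modularRange :=
  (MonoidHom.rangeRestrict_surjective _).countable

/-- Left multiplication by elements of the image of `SL(2, ℤ)` is measurable. [folklore] -/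
instance : MeasurableConstSMul modularRange SL(2, ℝ) :=
  ⟨fun σ ↦ measurable_const_mul (σ : SL(2, ℝ))⟩

/-- Haar measure is invariant under left multiplication by the image of `SL(2, ℤ)`. [folklore] -/
instance : SMulInvariantMeasure modularRange SL(2, ℝ) haar :=
  ⟨fun σ _s _hs ↦ measure_preimage_mul haar (σ : SL(2, ℝ)) _⟩

/-! ### The stabiliser of `i`: the half `K⁺` -/

/-- An element of `K = Stab(i)` has the form `(a -c; c a)`. [folklore] -/
lemma stabI_entries (k : stabI) :
    (k : SL(2, ℝ)) 0 1 = -((k : SL(2, ℝ)) 1 0) ∧ (k : SL(2, ℝ)) 1 1 = (k : SL(2, ℝ)) 0 0 := by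
  have h := stabI_smul_I k
  have h' := congrArg UpperHalfPlane.coe h
  rw [UpperHalfPlane.coe_specialLinearGroup_apply, UpperHalfPlane.coe_I,
    div_eq_iff (by
      have := UpperHalfPlane.denom_ne_zero (Matrix.SpecialLinearGroup.toGL ((k : SL(2, ℝ)))) UpperHalfPlane.I
      simpa [UpperHalfPlane.denom] using this)] at h'
  simp only [Algebra.algebraMap_self, RingHom.id_apply] at h'
  have hre := congrArg Complex.re h'
  have him := congrArg Complex.im h'
  simp at hre him
  exact ⟨by linarith, by linarith⟩

/-- For `k ∈ K`: `a² + c² = 1` with `a = k₀₀`, `c = k₁₀`. [folklore] -/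
lemma stabI_sq_add_sq (k : stabI) : (k : SL(2, ℝ)) 0 0 ^ 2 + (k : SL(2, ℝ)) 1 0 ^ 2 = 1 := by
  have hdet := Matrix.SpecialLinearGroup.det_coe (k : SL(2, ℝ))
  rw [Matrix.det_fin_two] at hdet
  obtain ⟨h1, h2⟩ := stabI_entries k
  rw [h1, h2] at hdet
  nlinarith [hdet]

/-- The half `K⁺ = {k_θ : θ ∈ [0, π)}` of the circle group `K`, described by the first column:
`c > 0`, or `c = 0` and `a > 0`. [folklore] -/
def kPlus : Set stabI := {k | 0 < (k : SL(2, ℝ)) 1 0 ∨ ((k : SL(2, ℝ)) 1 0 = 0 ∧ 0 < (k : SL(2, ℝ)) 0 0)}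

/-- `-1 ∈ K`. [folklore] -/
lemma neg_one_mem_stabI : (-1 : SL(2, ℝ)) ∈ stabI := by
  rw [MulAction.mem_stabilizer_iff]
  apply UpperHalfPlane.ext
  rw [UpperHalfPlane.coe_specialLinearGroup_apply]
  simp

/-- Negation inside `K`. [folklore] -/
def negK (k : stabI) : stabI := ⟨-1, neg_one_mem_stabI⟩ * k

/-- The underlying element of `negK k` is `-k`. [folklore] -/
@[simp] lemma coe_negK (k : stabI) : ((negK k : stabI) : SL(2, ℝ)) = -(k : SL(2, ℝ)) := by
  simp [negK]

/-- Entries of `-k`. [folklore] -/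
lemma neg_entry (g : SL(2, ℝ)) (i j : Fin 2) : (-g : SL(2, ℝ)) i j = -(g i j) := by
  rfl

/-- Exactly one of `k`, `-k` lies in `K⁺`: at least one does. [folklore] -/
lemma mem_kPlus_or_negK_mem (k : stabI) : k ∈ kPlus ∨ negK k ∈ kPlus := by
  simp only [kPlus, mem_setOf_eq, coe_negK, neg_entry]
  have hsq := stabI_sq_add_sq k
  rcases lt_trichotomy ((k : SL(2, ℝ)) 1 0) 0 with h | h | h
  · right; left; linarith
  · have ha : (k : SL(2, ℝ)) 0 0 = 1 ∨ (k : SL(2, ℝ)) 0 0 = -1 := by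
      rw [h] at hsq
      have : ((k : SL(2, ℝ)) 0 0) ^ 2 = 1 := by linarith
      exact mul_self_eq_one_iff.1 (by rw [← pow_two]; exact this)
    rcases ha with ha | ha
    · left; right; exact ⟨h, by rw [ha]; exact one_pos⟩
    · right; right; exact ⟨by rw [h, neg_zero], by rw [ha]; norm_num⟩
  · left; left; exact h

/-- Exactly one of `k`, `-k` lies in `K⁺`: not both. [folklore] -/
lemma not_mem_kPlus_and_negK_mem (k : stabI) : ¬ (k ∈ kPlus ∧ negK k ∈ kPlus) := by
  simp only [kPlus, mem_setOf_eq, coe_negK, neg_entry]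
  rintro ⟨h1 | ⟨h1, h1'⟩, h2 | ⟨h2, h2'⟩⟩ <;> linarith

/-- `K⁺` is measurable. [folklore] -/
lemma measurableSet_kPlus : MeasurableSet kPlus := by
  have hc : Continuous fun k : stabI ↦ (k : SL(2, ℝ)) 1 0 :=
    (continuous_entry 1 0).comp continuous_subtype_val
  have ha : Continuous fun k : stabI ↦ (k : SL(2, ℝ)) 0 0 :=
    (continuous_entry 0 0).comp continuous_subtype_val
  exact (isOpen_lt continuous_const hc).measurableSet.union
    ((isClosed_eq hc continuous_const).measurableSet.inter (isOpen_lt continuous_const ha).measurableSet)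

/-- The rotation by `π/2`, `(0 -1; 1 0) ∈ K⁺`: `K⁺` contains the non-empty open set `{c > 0}`. [folklore] -/
def rotQuarter : SL(2, ℝ) := ⟨!![0, -1; 1, 0], by simp [Matrix.det_fin_two_of]⟩

/-- The rotation by `π/2` fixes `i`. [folklore] -/
lemma rotQuarter_mem_stabI : rotQuarter ∈ stabI := by
  rw [MulAction.mem_stabilizer_iff]
  apply UpperHalfPlane.ext
  rw [UpperHalfPlane.coe_specialLinearGroup_apply, UpperHalfPlane.coe_I]
  simp [rotQuarter]

/-- `haarK (K⁺) > 0`: `K⁺` contains the open neighbourhood `{c > 0}` of the rotation by `π/2`. [folklore] -/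
lemma haarK_kPlus_pos : 0 < haarK kPlus := by
  have hc : Continuous fun k : stabI ↦ (k : SL(2, ℝ)) 1 0 :=
    (continuous_entry 1 0).comp continuous_subtype_val
  have hopen : IsOpen {k : stabI | 0 < (k : SL(2, ℝ)) 1 0} := isOpen_lt continuous_const hc
  have hne : ({k : stabI | 0 < (k : SL(2, ℝ)) 1 0}).Nonempty :=
    ⟨⟨rotQuarter, rotQuarter_mem_stabI⟩, by change (0 : ℝ) < 1; exact one_pos⟩
  exact (hopen.measure_pos haarK hne).trans_le (measure_mono fun k hk ↦ Or.inl hk)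

/-! ### The fundamental domain in `SL(2, ℝ)` -/

/-- **The fundamental domain** `{g ∈ SL(2, ℝ) : g • i ∈ 𝒟, κ(g) ∈ K⁺}` for the left action of
`SL(2, ℤ)` on `SL(2, ℝ)` (Lang, *SL₂(ℝ)*, Ch. III §1: `Γ \ G` fibres over `Γ \ ℍ` with fibre `K`, halved
by `-1 ∈ Γ`). [folklore] -/
def fdSL : Set SL(2, ℝ) := {g | g • UpperHalfPlane.I ∈ 𝒟 ∧ (iwasawa.symm g).2 ∈ kPlus}

/-- `fdSL` is the image of `𝒟 × K⁺` under the Iwasawa homeomorphism. [folklore] -/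
lemma preimage_iwasawa_fdSL : iwasawa ⁻¹' fdSL = (𝒟 : Set ℍ) ×ˢ kPlus := by
  ext ⟨z, k⟩
  simp only [fdSL, mem_preimage, mem_setOf_eq, iwasawa_smul_I, Homeomorph.symm_apply_apply, mem_prod]

/-- `fdSL` is measurable. [folklore] -/
lemma measurableSet_fdSL : MeasurableSet fdSL := by
  have : fdSL = iwasawa.symm ⁻¹' ((𝒟 : Set ℍ) ×ˢ kPlus) := by
    rw [← preimage_iwasawa_fdSL, ← preimage_comp, iwasawa.self_comp_symm, preimage_id]
  rw [this]
  exact (ModularGroup.isClosed_fd.measurableSet.prod measurableSet_kPlus).preimage iwasawa.symm.measurable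

/-- `haar (fdSL) = vol (𝒟) · haarK (K⁺)`. [folklore] -/
lemma haar_fdSL : haar fdSL = volume (𝒟 : Set ℍ) * haarK kPlus := by
  rw [haar, Measure.map_apply iwasawa.measurable measurableSet_fdSL, preimage_iwasawa_fdSL,
    Measure.prod_prod]

/-- `0 < haar (fdSL)`. [folklore] -/
lemma haar_fdSL_pos : 0 < haar fdSL := by
  rw [haar_fdSL]
  refine ENNReal.mul_pos ?_ haarK_kPlus_pos.ne'
  have h2 : (⟨2 * Complex.I, by simp⟩ : ℍ) ∈ 𝒟ᵒ := by
    constructor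
    · change 1 < Complex.normSq (2 * Complex.I)
      simp [Complex.normSq_apply]; norm_num
    · change |(2 * Complex.I).re| < 1 / 2
      simp
  have hsub : (𝒟ᵒ : Set ℍ) ⊆ 𝒟 := fun z hz ↦ ⟨hz.1.le, hz.2.le⟩
  exact ((ModularGroup.isOpen_fdo.measure_pos volume ⟨_, h2⟩).trans_le (measure_mono hsub)).ne'

/-- `haar (fdSL) < ∞` (finite covolume of `SL(2, ℤ)`, `vol 𝒟 = π/3`). [folklore] -/
lemma haar_fdSL_lt_top : haar fdSL < ⊤ := by
  rw [haar_fdSL]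
  exact ENNReal.mul_lt_top Literature.NumberTheory.Automorphic.volume_modular_fd_lt_top
    (measure_lt_top _ _)

/-- The coercion `SL(2, ℤ) → SL(2, ℝ)` commutes with negation. [folklore] -/
lemma coe_neg_SL2Z (γ : SL(2, ℤ)) : ((-γ : SL(2, ℤ)) : SL(2, ℝ)) = -(γ : SL(2, ℝ)) := by
  ext i j
  simp [Matrix.SpecialLinearGroup.coe_neg]

/-- `-g` acts on `ℍ` as `g` (the `SL(2, ℝ)` analogue of Mathlib's `ModularGroup.SL_neg_smul`, which is
stated for `SL(2, ℤ)`, and of `UpperHalfPlane.neg_smul` for `GL(2, ℝ)`). [folklore] -/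
lemma neg_smul_SL2R (g : SL(2, ℝ)) (z : ℍ) : (-g) • z = g • z := by
  apply UpperHalfPlane.ext
  rw [UpperHalfPlane.coe_specialLinearGroup_apply, UpperHalfPlane.coe_specialLinearGroup_apply]
  simp only [neg_entry, Algebra.algebraMap_self, RingHom.id_apply, Complex.ofReal_neg]
  rw [show -((g 0 0 : ℝ) : ℂ) * z + -((g 0 1 : ℝ) : ℂ) = -(((g 0 0 : ℝ) : ℂ) * z + ((g 0 1 : ℝ) : ℂ)) by ring,
    show -((g 1 0 : ℝ) : ℂ) * z + -((g 1 1 : ℝ) : ℂ) = -(((g 1 0 : ℝ) : ℂ) * z + ((g 1 1 : ℝ) : ℂ)) by ring,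
    neg_div_neg_eq]

/-- Iwasawa coordinates of `-g`: same point of `ℍ`, negated `K`-part. [folklore] -/
lemma iwasawa_symm_neg (g : SL(2, ℝ)) :
    iwasawa.symm (-g) = ((iwasawa.symm g).1, negK (iwasawa.symm g).2) := by
  apply iwasawa.injective
  rw [Homeomorph.apply_symm_apply, iwasawa_apply]
  conv_lhs => rw [← iwasawa.apply_symm_apply g, iwasawa_apply]
  rw [coe_negK, mul_neg]

/-- The first Iwasawa coordinate is the orbit point `g • i`. [folklore] -/
lemma iwasawa_symm_fst (g : SL(2, ℝ)) : (iwasawa.symm g).1 = g • UpperHalfPlane.I := rfl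

/-- Membership of `-g` in the fundamental domain. [folklore] -/
lemma neg_mem_fdSL_iff (g : SL(2, ℝ)) :
    -g ∈ fdSL ↔ g • UpperHalfPlane.I ∈ 𝒟 ∧ negK (iwasawa.symm g).2 ∈ kPlus := by
  rw [fdSL, mem_setOf_eq, iwasawa_symm_neg, neg_smul_SL2R]

/-- `SL(2, ℝ)` preserves the hyperbolic area of sets (image form of
`SL2R.measurePreserving_smul_upperHalfPlane`, i.e. of Mathlib's `GL(2, ℝ)`-invariance of `volume`). [folklore] -/
lemma volume_smul_image (h : SL(2, ℝ)) {s : Set ℍ} (hs : MeasurableSet s) :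
    volume ((h • ·) '' s) = volume s := by
  rw [image_smul, ← preimage_smul_inv]
  exact (measurePreserving_smul_upperHalfPlane h⁻¹).measure_preimage hs.nullMeasurableSet

/-- `𝒟 \ 𝒟ᵒ` is measurable. [folklore] -/
lemma measurableSet_fd_diff_fdo : MeasurableSet ((𝒟 : Set ℍ) \ 𝒟ᵒ) :=
  ModularGroup.isClosed_fd.measurableSet.diff ModularGroup.isOpen_fdo.measurableSet

/-- **`fdSL` is a fundamental domain** for the left action of (the image of) `SL(2, ℤ)` on
`SL(2, ℝ)` with respect to Haar measure: every orbit meets it (`ModularGroup.exists_smul_mem_fd` plus the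
choice of sign in `K⁺`), and distinct translates meet only above the null set `𝒟 \ 𝒟ᵒ`
(`ModularGroup.eq_one_or_neg_one_of_mem_fdo_mem_fd`). [folklore] -/
theorem isFundamentalDomain_fdSL : IsFundamentalDomain modularRange fdSL haar := by
  refine IsFundamentalDomain.mk'' measurableSet_fdSL.nullMeasurableSet ?_ ?_ ?_
  · refine Eventually.of_forall fun g ↦ ?_
    obtain ⟨γ₀, hγ₀⟩ := ModularGroup.exists_smul_mem_fd (g • UpperHalfPlane.I)
    have hg' : ((γ₀ : SL(2, ℝ)) * g) • UpperHalfPlane.I ∈ 𝒟 := by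
      rw [mul_smul, coe_smul_eq]; exact hγ₀
    rcases mem_kPlus_or_negK_mem (iwasawa.symm ((γ₀ : SL(2, ℝ)) * g)).2 with h | h
    · exact ⟨⟨γ₀, γ₀, rfl⟩, hg', h⟩
    · refine ⟨⟨((-γ₀ : SL(2, ℤ)) : SL(2, ℝ)), -γ₀, rfl⟩, ?_⟩
      change ((-γ₀ : SL(2, ℤ)) : SL(2, ℝ)) * g ∈ fdSL
      rw [coe_neg_SL2Z, neg_mul, neg_mem_fdSL_iff]
      exact ⟨hg', h⟩
  · intro σ hσ
    obtain ⟨γ, hγ⟩ : ∃ γ : SL(2, ℤ), (γ : SL(2, ℝ)) = σ := σ.2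
    have hsub : (σ • fdSL) ∩ fdSL ⊆
        {g : SL(2, ℝ) | g • UpperHalfPlane.I ∈ (((σ : SL(2, ℝ)) • ·) '' ((𝒟 : Set ℍ) \ 𝒟ᵒ))} := by
      rintro g ⟨hg1, hg2⟩
      obtain ⟨g₀, hg₀, rfl⟩ := Set.mem_smul_set.1 hg1
      refine ⟨g₀ • UpperHalfPlane.I, ⟨hg₀.1, fun hz₀ ↦ ?_⟩, ?_⟩
      · have hz : γ • (g₀ • UpperHalfPlane.I) ∈ 𝒟 := by
          rw [← coe_smul_eq, hγ, ← mul_smul]; exact hg2.1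
        rcases ModularGroup.eq_one_or_neg_one_of_mem_fdo_mem_fd hz₀ hz with rfl | rfl
        · apply hσ
          ext1
          rw [← hγ, map_one, OneMemClass.coe_one]
        · have hσg : (σ : SL(2, ℝ)) * g₀ = -g₀ := by rw [← hγ, coe_neg_SL2Z, map_one, neg_one_mul]
          have h2 : (iwasawa.symm ((σ : SL(2, ℝ)) * g₀)).2 ∈ kPlus := hg2.2
          rw [hσg, iwasawa_symm_neg] at h2
          exact not_mem_kPlus_and_negK_mem _ ⟨hg₀.2, h2⟩
      · change (σ : SL(2, ℝ)) • g₀ • UpperHalfPlane.I = ((σ : SL(2, ℝ)) * g₀) • UpperHalfPlane.I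
        rw [mul_smul]
    refine measure_mono_null hsub (haar_preimage_smul_null ?_ _)
    rw [volume_smul_image _ measurableSet_fd_diff_fdo]
    exact Literature.NumberTheory.Automorphic.volume_modular_fd_diff_fdo
  · intro σ
    exact (measurePreserving_mul_left haar (σ : SL(2, ℝ))).quasiMeasurePreserving

/-! ### The driving law and its right-translation invariance on invariant observables -/

/-- **The driving law**: Haar measure restricted to the fundamental domain `fdSL`, normalised — the
law of a uniform point of `SL(2, ℤ) \ SL(2, ℝ)` read in `fdSL`. [folklore] -/
def drivingLaw : Measure SL(2, ℝ) := (haar fdSL)⁻¹ • haar.restrict fdSL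

/-- The driving law on a measurable set. [folklore] -/
lemma drivingLaw_apply {A : Set SL(2, ℝ)} (hA : MeasurableSet A) :
    drivingLaw A = (haar fdSL)⁻¹ * haar (A ∩ fdSL) := by
  rw [drivingLaw, Measure.smul_apply, Measure.restrict_apply hA, smul_eq_mul]

/-- The driving law is a probability measure. [folklore] -/
instance isProbabilityMeasure_drivingLaw : IsProbabilityMeasure drivingLaw :=
  ⟨by rw [drivingLaw_apply MeasurableSet.univ, univ_inter,
    ENNReal.inv_mul_cancel haar_fdSL_pos.ne' haar_fdSL_lt_top.ne]⟩

/-- The driving law is dominated by a multiple of Haar measure. [folklore] -/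
lemma drivingLaw_le (A : Set SL(2, ℝ)) : drivingLaw A ≤ (haar fdSL)⁻¹ * haar A := by
  rw [drivingLaw, Measure.smul_apply, smul_eq_mul]
  gcongr
  exact Measure.restrict_le_self

/-- A right translate of the fundamental domain is a fundamental domain. [folklore] -/
lemma isFundamentalDomain_preimage_mul_right (h : SL(2, ℝ)) :
    IsFundamentalDomain modularRange ((· * h) ⁻¹' fdSL) haar :=
  isFundamentalDomain_fdSL.preimage_of_equiv
    (measurePreserving_mul_right haar h).quasiMeasurePreserving Function.bijective_id
    fun σ g ↦ by
      change ((σ : SL(2, ℝ)) * g) * h = (σ : SL(2, ℝ)) * (g * h)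
      exact mul_assoc _ _ _

/-- **Right-translation invariance on `SL(2, ℤ)`-invariant sets**: for a measurable `A` invariant
under left multiplication by `SL(2, ℤ)`, `haar (A h⁻¹ ∩ fdSL) = haar (A ∩ fdSL)` — unimodularity of
`SL(2, ℝ)` and independence of the fundamental domain (Lang, *SL₂(ℝ)*, Ch. III §1). [folklore] -/
theorem haar_preimage_mul_right_inter_fdSL {A : Set SL(2, ℝ)} (hA : MeasurableSet A)
    (hinv : ∀ γ : SL(2, ℤ), ((γ : SL(2, ℝ)) * ·) ⁻¹' A = A) (h : SL(2, ℝ)) :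
    haar (((· * h) ⁻¹' A) ∩ fdSL) = haar (A ∩ fdSL) := by
  have hset : ((· * h) ⁻¹' A) ∩ fdSL = (· * h) ⁻¹' (A ∩ (· * h⁻¹) ⁻¹' fdSL) := by
    ext g
    simp only [mem_inter_iff, mem_preimage, mul_inv_cancel_right]
  rw [hset, measure_preimage_mul_right]
  refine (isFundamentalDomain_preimage_mul_right h⁻¹).measure_set_eq isFundamentalDomain_fdSL hA
    fun σ ↦ ?_
  obtain ⟨γ, hγ⟩ : ∃ γ : SL(2, ℤ), (γ : SL(2, ℝ)) = σ := σ.2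
  change (fun x ↦ (σ : SL(2, ℝ)) * x) ⁻¹' A = A
  rw [← hγ]
  exact hinv γ

/-- The driving law of a right translate of an `SL(2, ℤ)`-invariant measurable set. [folklore] -/
theorem drivingLaw_preimage_mul_right {A : Set SL(2, ℝ)} (hA : MeasurableSet A)
    (hinv : ∀ γ : SL(2, ℤ), ((γ : SL(2, ℝ)) * ·) ⁻¹' A = A) (h : SL(2, ℝ)) :
    drivingLaw ((· * h) ⁻¹' A) = drivingLaw A := by
  rw [drivingLaw_apply (measurable_mul_const h hA), drivingLaw_apply hA,
    haar_preimage_mul_right_inter_fdSL hA hinv h]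

/-! ### The law of the modular loop ensemble and its Möbius invariance -/

/-- **The law of the modular loop ensemble**: the image of the driving law under `g ↦ modularLoops g`.
[folklore] -/
def modularLaw : Measure (LoopSpace ℂ) := drivingLaw.map modularLoops

/-- The law of the ensemble is a probability measure. [folklore] -/
instance isProbabilityMeasure_modularLaw : IsProbabilityMeasure modularLaw :=
  Measure.isProbabilityMeasure_map continuous_modularLoops.measurable.aemeasurable

/-- Driving by `g h` instead of `g` does not change the law of the ensemble. [folklore] -/
theorem map_modularLoops_mul_right (h : SL(2, ℝ)) :
    drivingLaw.map (fun g ↦ modularLoops (g * h)) = modularLaw := by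
  have hmeas : Measurable fun g : SL(2, ℝ) ↦ modularLoops (g * h) :=
    continuous_modularLoops.measurable.comp (measurable_mul_const h)
  ext E hE
  rw [Measure.map_apply hmeas hE, modularLaw, Measure.map_apply continuous_modularLoops.measurable hE]
  exact drivingLaw_preimage_mul_right (continuous_modularLoops.measurable hE)
    (fun γ ↦ by ext g; simp only [mem_preimage, modularLoops_coe_mul]) h

/-- **Möbius invariance of the law of the modular loop ensemble**: the push-forward of `modularLaw`
along any uniformly continuous map of `ℂ` that agrees with a disc Möbius map `C h C⁻¹`, `h ∈ SL(2, ℝ)`,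
on the open unit disc is `modularLaw` itself. [folklore] -/
theorem map_modularLaw_eq {M : C(ℂ, ℂ)} {h : SL(2, ℝ)} (hMu : UniformContinuous M)
    (hM : ∀ w : ℂ, ‖w‖ < 1 → M w = diskMoebius h w) :
    modularLaw.map (LoopSpace.map M) = modularLaw := by
  rw [modularLaw, Measure.map_map (LoopSpace.measurable_map_of_uniformContinuous hMu)
    continuous_modularLoops.measurable]
  have : LoopSpace.map M ∘ modularLoops = fun g ↦ modularLoops (g * h⁻¹) :=
    funext fun g ↦ map_modularLoops_of_eqOn_ball hMu hM g
  rw [this]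
  exact map_modularLoops_mul_right h⁻¹

/-- Möbius invariance, form with the extended disc Möbius map of `h`. [folklore] -/
theorem map_modularLaw_diskMoebiusExt (h : SL(2, ℝ)) :
    modularLaw.map (LoopSpace.map (diskMoebiusExt h)) = modularLaw :=
  map_modularLaw_eq (uniformContinuous_diskMoebiusExt h) fun _ hw ↦ diskMoebiusExt_of_norm_le_one h hw.le

/-! ### Almost surely the moved point lies in a translate of the open fundamental domain -/

/-- Null sets of `ℍ` pull back to null sets of the driving law under every orbit map. [folklore] -/
theorem drivingLaw_null_of_volume_null {s : Set ℍ} (hs : volume s = 0) (z₀ : ℍ) :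
    drivingLaw {g | g • z₀ ∈ s} = 0 := by
  have := drivingLaw_le {g : SL(2, ℝ) | g • z₀ ∈ s}
  rw [haar_preimage_smul_null hs z₀, mul_zero] at this
  exact nonpos_iff_eq_zero.1 this

/-- **Almost surely (for the driving law) the moved point `g • z₀` lies in an `SL(2, ℤ)`-translate of
the open fundamental domain `𝒟ᵒ`**: the boundary `𝒟 \ 𝒟ᵒ` and its countably many translates are null.
[folklore] -/
theorem ae_exists_smul_mem_fdo (z₀ : ℍ) : ∀ᵐ g ∂drivingLaw, ∃ γ : SL(2, ℤ), γ • (g • z₀) ∈ 𝒟ᵒ := by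
  have hnull : drivingLaw (⋃ γ : SL(2, ℤ),
      {g : SL(2, ℝ) | g • z₀ ∈ (((γ : SL(2, ℝ)) • ·) '' ((𝒟 : Set ℍ) \ 𝒟ᵒ))}) = 0 := by
    refine measure_iUnion_null fun γ ↦ drivingLaw_null_of_volume_null ?_ z₀
    rw [volume_smul_image _ measurableSet_fd_diff_fdo]
    exact Literature.NumberTheory.Automorphic.volume_modular_fd_diff_fdo
  rw [ae_iff]
  refine measure_mono_null (fun g hg ↦ ?_) hnull
  simp only [mem_setOf_eq, not_exists] at hg
  obtain ⟨γ₀, hγ₀⟩ := ModularGroup.exists_smul_mem_fd (g • z₀)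
  refine mem_iUnion.2 ⟨γ₀⁻¹, γ₀ • (g • z₀), ⟨hγ₀, hg γ₀⟩, ?_⟩
  change ((γ₀⁻¹ : SL(2, ℤ)) : SL(2, ℝ)) • γ₀ • g • z₀ = g • z₀
  rw [coe_smul_eq, inv_smul_smul]

end ModularEnsemble

end Literature.Probability.RandomPlanarGeometry
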